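import Mathlib
import Literature.MathematicalPhysics.QuantumFieldTheory.Balaban1983to89.B2

/-!
# `Balaban1983to89.B2StepK` — B2 §2.B–§2.D pp. 566–582: the inductive hypothesis (2.43), the cut-off background
field (2.44), the restrictions (2.55), Propositions 2.1 (p. 570), 2.2 (pp. 570–571), 2.6 (p. 580), Lemmas 2.3
(p. 571), 2.5 (p. 574), 2.7 (p. 581), the kernel bound (2.109), the final step (2.116)–(2.118) — statements typed;
KERNEL-PROVED: the algebra (2.61) of Lemma 2.3's proof, the computation (2.83)–(2.85) of Lemma 2.5's proof, (2.86),
and the geometric-series bound (2.118)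

HONEST FRAMING (lit-balaban, verbatim): statement-level skeleton of published theorems with citation tags; proofs
where landed; nothing here is a claim about the Yang–Mills mass gap.

B2 = T. Bałaban, *(Higgs)₂,₃ quantum fields in a finite volume. II. An upper bound*, Commun. Math. Phys. **86**,
555–594 (1982) [Balaban1982Higgs2] (held: `paper:balaban1982-cmp86-higgs23-ii`; journal page = PDF page + 554);
quotations from the ×2 renders `…/pages/1982-cmp86-higgs23-II/…-p012, p016, p017, p020, p021, p026, p027, p028-x2.png`
(pp. 566, 570, 571, 574, 575, 580, 581, 582) of the cell `pub-balaban`.  Unit `lit-balaban-r14` (READER/TYPER of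
B1–B2); SKELETON rows B2-2.43 … B2-2.118.  RELATION TO THE TREE: `…Balaban1983to89.B2` (b2b-pv04/pv07) types Lemma
2.4 (2.65)–(2.66) with the algebra of its proof ((2.62)–(2.63) = `B2.display263`, (2.68)–(2.75)), the conditional
integration (2.28), Prop. 3.1, (3.42) and the stopping rule `B2.Run.StopsAt`; `…B1` types Props. I.2.1–I.2.3 (which
Prop. 2.2 below is "a simple corollary of"); `…B2LargeField` (this unit, sibling proposal) the §2.A apparatus
(2.2)–(2.17) — not imported here (the thresholds of (2.55) enter as the two numbers they are).  B2's Theorem (1.3)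
p. 556 restates B1's Theorem (1.14): typed once, as `…B1LowerBound.ThmPrinted` (this unit), whose half
`UpperBoundPrinted` is what B2 proves.  Nothing of those modules is restated; this module is imported by nothing yet.

THE SOURCE TEXT, verbatim.  p. 566 [PDF 12]: *"B. Inductive Description of the Action after k Steps. Now we will write
the expressions and their estimates we get after k steps of the renormalization procedure. We have
Z^ε ≤ ∫dA∫dφ Σ_{Λ₀^{(k−1)}⊂T₁^{(k−1)}, admissible} … Σ_{Λ₀^{(0)}⊂T₁, admissible} ρ^{(k),L^kε}(Λ₀^{(0)},…,Λ₀^{(k−1)}, A,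
θ_kA^{(k),ε}, φ) · exp(𝒫^{(k),L^kε}(Λ₇^{(k−1)}′, θ_kA^{(k),ε}, φ) − E₀ + Σ_{j=0}^{k−1} O((L^jε)^{κ₀})|Λ₇^{(j−1)}′ ∩ Λ₇^{(j)c}|)
· exp(Σ_{j=0}^{k−1} O((L^jε)^κ)|T₁^{(j)}|). (2.43) Here the word "admissible" means that the sets Λ₀^{(j)} have to
satisfy all the conditions resulting from the construction. … At first we have the following formula for A^{(k),ε}
A^{(k),ε} = a_k(L^kε)^{−2}ζ^{(k)}G^ε_kQ^*_kA, (2.44) where the function ζ^{(k)}(x,y) is defined for x ∈ T_η, y ∈ T₁^{(k)},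
is "smooth" with respect to x in the sense that |(∂^η_xζ^{(k)})(b,y)| ≤ 1, supp ζ^{(k)}(·,y) is contained in the set
{x ∈ T_η : |x − y| < r(L^kε) − 2M} and ζ^{(k)}(x,y) = 1 if |x − y| ≤ ½r(L^kε)."* (p. 561: *"ζC^{(0)}Q* denotes an operator
with the kernel ζ(x,y)(C^{(0)}Q*)(x,y)"* — the cut-off is entrywise.)
p. 570 [PDF 16]: *"and the restrictions on the fields A, φ given by the characteristic functions χ_k: |(∂A)(b)| ≤
c₁p(L^{k−1}ε), |A(x)| ≤ (c₁/(μ₀L^{k−1}ε))p(L^{k−1}ε), |(D_{Ā^{(k)}}φ)(b)| ≤ c₁p(L^{k−1}ε), |φ(x)| ≤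
(c₁/λ(L^{k−1}ε)^{1/4})p(L^{k−1}ε) for x ∈ Λ^{(k−1)}′_{−1}, b ⊂ Λ^{(k−1)}′_{−1}, Ā^{(k)}_b = L^{−k}Σ_{⟨x,x′⟩⊂b}A^{(k)}_{⟨x,x′⟩}.
(2.55) … φ^{(k)} = a_kG_k(B^k(Λ₂^{(k−1)}′),A^{(k)})Q_k^*(A^{(k)})Λ₆^{(k−1)}′φ. (2.56) Such a possibility is assured by the
following theorem. **Proposition 2.1.** Under the conditions (2.55), we have 𝒫^{(k)}(Λ₇^{(k−1)}′, θ_kA^{(k)}, φ) =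
−λ(L^kε)Σ_{x∈B^k(Λ₇^{(k−1)}′∩Λ₇^{(k)c})} η^d|φ^{(k)}(x)|⁴ + 𝒫^{(k)}(Λ₇^{(k)}, θ_kA^{(k)}, φ) + O((L^kε)^{κ₀})|Λ₇^{(k−1)}′ ∩
Λ₇^{(k)c}|. (2.57) Similar conclusions hold for other expressions which will be included in the action in the later
stages of the procedure. This theorem is a corollary of the analysis of the perturbation expansions. …
**Proposition 2.2.** Let Ω and A satisfy the assumptions of Proposition I.2.1, then for e(L^kε) sufficiently small
there exist positive constants δ₀, c₀, R₀ independent of A, k, Ω and depending on d, a, M, such that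
|(D^η_AG_k(Ω,A)Q_k^*(A))(b,y)| ≤ c₀exp(−δ₀dist(b,y)), (2.58)"* p. 571 [PDF 17]: *"for b ⊂ Ω, dist(b,Ωᶜ) ≥ R₀, y ∈ Ω^{(k)}.
The identical inequality holds for G_k(Ω,A)Q_k^*(A), and for D^η_AδG_k(Ω,Ω₀,A)Q_k^*(A), δG_k(Ω,Ω₀,A)Q_k^*(A) with the
additional factor exp(−δ₀(dist(b,Ωᶜ) + dist(y,Ωᶜ))). This proposition is a simple corollary of Proposition I.2.1. …
**Lemma 2.3.** Under the restrictions (2.55), we have A^{(k)}(x) = A(y) + O(p(L^kε)) = (Q^*_kA)(x) + O(p(L^kε)),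
x ∈ B^k(y), y ∈ Λ₂^{(k−1)}′, (2.59) (∂^η_μA^{(k)})(x) = O(p(L^kε)), x ∈ B^k(Λ₂^{(k−1)}′). (2.60) … We have A^{(k)}(x) =
a_k(ζ^{(k)}G_kQ_k^*(A − A(y)))(x) − a_k((1 − ζ^{(k)})G_kQ_k^*1)(x)A(y) + a_k(G_kQ_k^*1)(x)A(y), x ∈ B^k(y), y ∈ Λ₂^{(k−1)}′.
(2.61)"* (then (2.62)–(2.64); (2.63) = `B2.display263`).
p. 574 [PDF 20]: *"We make the translation A = A′ + aL^{−2}C^{(k)}_{Λ₀^{(k)}}Q^*B. (2.80) … **Lemma 2.5.**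
aL^{−2}(C^{(k)}_{Λ₀^{(k)}}Q^*B)(x) = B(y) + O(p(L^kε)) = (Q^*B)(x) + O(p(L^kε)), x ∈ B(y), y ∈ Λ₁^{(k)}′. (2.81) … We have to
calculate aL^{−2}C^{(k)}Q^*1 = aL^{−2}C^{(k)}1 … aL^{−2}C^{(k)}1 = C^{(k)}aL^{−2}P1 = C^{(k)}(Δ^{(k)} + aL^{−2}P)1 − C^{(k)}Δ^{(k)}1 =
1 − C^{(k)}Δ^{(k)}1. (2.83) We have to calculate Δ^{(k)}1. From the equalities (I.2.21) and (2.63) we get Δ^{(k)}1 = a_k1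
− a_k²Q_kG_kQ_k^*1 = a_k1 − a_k(1 − μ₀²(L^kε)²/(a_k + μ₀²(L^kε)²)) = a_kμ₀²(L^kε)²/(a_k + μ₀²(L^kε)²), (2.84)"* p. 575 [PDF 21]:
*"and hence aL^{−2}C^{(k)}1 = (1 + a^{−1}L²a_kμ₀²(L^kε)²/(a_k + μ₀²(L^kε)²))^{−1} = 1 + O(μ₀²(L^kε)²). (2.85) This together
with (2.82) proves (2.81). From the above lemma and the restrictions on the fields B, A it follows that the field A′
is small on Λ₁^{(k)}: |A′(x)| = |A(x) − aL^{−2}(C^{(k)}_{Λ₀^{(k)}}Q^*B)(x)| ≤ |A(x) − (Q^*B)(x)| + O(1)p(L^kε) ≤ O(1)p(L^kε).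
(2.86)"*  p. 580 [PDF 26]: *"**Proposition 2.6.** If in the interaction terms localized in B^k(Λ₇^{(k)}) we replace
the propagator G_k(B^{k−1}(Λ₂^{(k−1)}), B̃) by G_k(B^k(Λ₂^{(k)}), B^{(k+1),η}), then all the terms containing at least
one difference of these propagators can be estimated by O((L^kε)^κ)|Λ₇^{(k)}|. … More exactly the difference between
the quadratic forms is a quadratic form ½⟨Λ₆^{(k−1)}′φ, H_kΛ₆^{(k−1)}′φ⟩ and for the matrix elements h_k(x,x′) of the
operator H_k of this form, the following inequality holds |h_k(x,x′)| ≤ O(1)exp(−δ₁r(L^kε))exp(−δ₀|x − x′|) ≤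
O((L^kε)^κ)exp(−δ₀|x − x′|) (2.109) for x, x′ ∈ Λ₆^{(k−1)}′ and arbitrary κ."*  p. 581 [PDF 27]: *"**Lemma 2.7.** The
following estimate holds aL^{−2}(C^{(k)}_{Λ₄^{(k)}}(B^k(Λ₂^{(k)}),B^{(k+1),η})Q^*(B^{(k+1),η})ψ)(x) = (Q^*(B^{(k+1),η})ψ)(x) +
O(p(L^kε)), x ∈ Λ₅^{(k)}. (2.113) A proof of this lemma is based on the ideas which were described before in the proofs
of Lemmas 2.4 and 2.5, so we omit it here. Lemma 2.7 and the restrictions on the fields ψ, φ imply |φ′(x)| ≤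
O(1)p(L^kε), x ∈ Λ₅^{(k)}. (2.114)"*  p. 582 [PDF 28]: *"D. The Final Step. The procedure is continued until k = K,
where K is such that L^Kε ≤ ε₀, L^{K+1}ε > ε₀. Then we estimate 𝒫^{(K),L^Kε}(Λ₇^{(K−1)}, B^{(K),ε}, ψ) ≤
O((L^Kε)^{κ₀})|Λ₇^{(K)}|. (2.116) Now it is sufficient to prove the estimate ∫dB∫dψ Σ_{Λ₀^{(0)},…,Λ₀^{(K−1)}}
ρ^{(K),L^Kε}(Λ₀^{(0)},…,Λ₀^{(K−1)}, B, θ_KB^{(K),ε}, ψ)exp(−E₀)·exp(O(1)ε^{κ₀}|Λ₇^{(0)c}| + Σ_{j=1}^{K−1}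
O(1)(L^jε)^{κ₀}|Λ₇^{(j−1)}′∩Λ₇^{(j)c}| + O(1)(L^{K−1}ε)^{κ₀}|Λ₇^{(K−1)}|) ≤ exp(O(1)|T_ε|), (2.117) with the constant O(1)
independent of ε, because for the last sum in the exponent on the right side of (2.43), we have Σ_{j=0}^{K−1}
O((L^jε)^κ)|T₁^{(j)}| = Σ_{j=0}^{K−1} O(1)(L^jε)^{κ₀}|T_ε| ≤ O(1)|T_ε|. (2.118) The inequality (2.117) will be proved in the
next chapter."*

WHAT IS TYPED / KERNEL-CHECKED.  (2.43) `IndHyp243` over a carrier whose field `rhs k c c′` NAMES the right side of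
(2.43) as a function of the two families of O-coefficients (c_j at the volume differences, c′_j at |T₁^{(j)}|), so
that "O(·)" is typed as "some coefficients bounded by one constant"; (2.44) CONCRETELY as the entrywise cut-off of a
kernel (`bg244`, Mathlib's Hadamard product `⊙`) with the printed properties of ζ^{(k)} (`IsCutoff244`); (2.55) as the
pointwise predicate `Restr255At` (thresholds as numbers; `bondAvg` = Ā^{(k)}_b); Props. 2.1, 2.2, 2.6, Lemmas 2.3,
2.5, 2.7, (2.109) with *"arbitrary κ"* (`RDecayBeatsPowers` — KERNEL since v1.1: `rDecayBeatsPowers` for δ₁, R > 0,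
r > 1, with C_κ = e^{|κ|T}, T = (κ/δ₁R)^{1/(r−1)} for κ > 0), (2.116), (2.117) over carriers whose fields NAME the
printed quantities (`Prop21Printed`, `Prop22Printed`, `Prop26Printed`, `Lemma23Printed`, `Lemma25Printed`,
`Lemma27Printed`, `Ineq2116Printed`, `Ineq2117Printed`) — Props. 2.1, 2.6 are B3's ("corollary of the analysis of the
perturbation expansions"), Prop. 2.2 is "a simple corollary of Proposition I.2.1" (B4's theorem), Lemmas 2.3, 2.5 are
proved in print from Prop. 2.2/I.2.3 + (2.55), Lemma 2.7's proof is "omitted"; KERNEL: `display261` (the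
decomposition (2.61), module algebra), `display284`, `display285`, `display285_bound` (the computation (2.83)–(2.85)
and its "= 1 + O(μ₀²(L^kε)²)" with the explicit constant L²/a), `display286` (triangle inequality), and (2.118)
(`sum_scale_rpow_le`: Σ_{j<K}(L^jε)^{κ₀} ≤ 1/(L^{κ₀} − 1) whenever L^Kε ≤ 1, L > 1, κ₀ > 0; `display2118`).

v1.1 (2026-08-20, APPEND-ONLY): `rDecayBeatsPowers`, `rDecayBeatsPowers_of_printed`, `kernelBound2109_pow_of_printed`
(section `RDecayProof`).  v1.2 (2026-08-21, DOCSTRING-ONLY; referee ref-2 I2 ask, gens 4–6): CROSS-NAMING — the nine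
§2 statements typed here ((2.43) `Run243`/`IndHyp243`, Prop. 2.1 `P21Setting`/`Prop21Printed`, (2.116)
`Ineq2116Printed`, Prop. 2.2 `P22Setting`/`Prop22Printed`, Lemma 2.3 `L23Setting`/`Lemma23Printed`, Lemma 2.5
`L25Setting`/`Lemma25Printed`, Prop. 2.6 `P26Setting`/`Prop26Printed`, Lemma 2.7 `L27Setting`/`Lemma27Printed`,
(2.117) `Run2117`/`Ineq2117Printed`) are TWINS of unit r02's `…B2Sect2Statements.{Run243/Ineq243Printed,
P21Setting/Prop21Printed, Ineq2116, P22Setting/Prop22Printed, L23Setting/Lemma23Printed, L25Setting/Lemma25Printed,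
P26Setting/Prop26Printed, L27Setting/Lemma27Printed, FinalRun/Claim2117Printed}` (typed independently the same
evening, landed first): the DECLS OF RECORD of the SKELETON rows B2.Eq2.43, B2.Prop2.1, B2.Lem2.3, B2.Lem2.5,
B2.Prop2.6, B2.Lem2.7, B2.Eq2.116, B2.Eq2.117 are r02's `B2Sect2Statements.*`; for B2.Prop2.2 this module's
`Prop22Printed` is of record (r02 ruling 2026-08-20T23:06Z).  r02's carriers index ONE instance and expose suprema,
this module's index RUNS with the step k inside and expose pointwise quantities; the dictionaries and bridge lemmas
between the twins (Props. 2.1, 2.6, Lemmas 2.3, 2.5, 2.7, (2.116), (2.117)) are in the sibling module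
`…B2StepKSect2Bridge` (which imports both; this module's imports are unchanged).  No declaration is changed.
-/

open scoped BigOperators Matrix
open Finset

namespace Literature.MathematicalPhysics.QuantumFieldTheory.Balaban1983to89.B2StepK

/-! ## (2.43) p. 566: the inductive hypothesis of the upper bound -/

/-- Carrier for (2.43): one RUN (lattice spacing `eps`, block size `L`, `K` steps, dimension `d`) with, for each k,
`rhs k c c′` ↤ the right side of (2.43) — ∫dA∫dφ Σ_{admissible Λ₀^{(0)},…,Λ₀^{(k−1)}} ρ^{(k),L^kε}(…)·exp(𝒫^{(k),L^kε}(…) −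
E₀ + Σ_{j<k} c_j(L^jε)^{κ₀}|Λ₇^{(j−1)}′∩Λ₇^{(j)c}|)·exp(Σ_{j<k} c′_j(L^jε)^κ|T₁^{(j)}|) — as a function of the two
coefficient families (the volume differences depend on the summation variable, so the O-terms cannot be factored);
`Z` ↤ Z^ε; `kappa0`, `kappa` ↤ the exponents κ₀ > 0, κ > d fixed by the construction. [cite: Balaban1982Higgs2, (2.43) p.566] -/
structure Run243 where
  eps : ℝ
  L : ℝ
  K : ℕ
  d : ℕ
  kappa0 : ℝ
  kappa : ℝ
  Z : ℝ
  rhs : ℕ → (ℕ → ℝ) → (ℕ → ℝ) → ℝ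

/-- **(2.43)** p. 566 TYPED: for every step k ≤ K the bound holds with O-coefficients bounded by ONE constant
(independent of k and ε), κ₀ > 0, κ > d. [cite: Balaban1982Higgs2, (2.43) p.566] -/
def IndHyp243 {J : Type} (fam : J → Run243) : Prop :=
  ∃ C : ℝ, ∀ j : J, 0 < (fam j).kappa0 ∧ ((fam j).d : ℝ) < (fam j).kappa ∧
    ∀ k : ℕ, k ≤ (fam j).K → ∃ c c' : ℕ → ℝ, (∀ i, |c i| ≤ C) ∧ (∀ i, |c' i| ≤ C) ∧
      (fam j).Z ≤ (fam j).rhs k c c'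

/-! ## (2.44) p. 566: the cut-off background field -/

/-- **(2.44)** p. 566: A^{(k),ε} = a_k(L^kε)^{−2}ζ^{(k)}G^ε_kQ^*_kA, where *"ζ^{(k)}G^ε_kQ^*_k"* is the operator with KERNEL
ζ^{(k)}(x,y)·(G^ε_kQ^*_k)(x,y) (p. 561) — CONCRETELY the entrywise (Hadamard) cut-off: DICTIONARY `X` ↤ T_η, `Y` ↤
T₁^{(k)}, `ζ` ↤ ζ^{(k)}, `GQs` ↤ the kernel of G^ε_kQ^*_k, `A : Y → ℝ` ↤ one component of the block field, `ak`, `ℓ` ↤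
a_k, L^kε. [cite: Balaban1982Higgs2, (2.44) p.566] -/
noncomputable def bg244 {X Y : Type} [Fintype Y] (ak ℓ : ℝ) (ζ GQs : Matrix X Y ℝ) (A : Y → ℝ) : X → ℝ :=
  (ak * (ℓ ^ 2)⁻¹) • ((ζ ⊙ GQs) *ᵥ A)

/-- Pointwise form of (2.44): A^{(k),ε}(x) = a_k(L^kε)^{−2}Σ_y ζ^{(k)}(x,y)(G^ε_kQ^*_k)(x,y)A(y). KERNEL (unfolding).
[cite: Balaban1982Higgs2, (2.44) p.566] -/
theorem bg244_apply {X Y : Type} [Fintype Y] (ak ℓ : ℝ) (ζ GQs : Matrix X Y ℝ) (A : Y → ℝ) (x : X) :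
    bg244 ak ℓ ζ GQs A x = ak * (ℓ ^ 2)⁻¹ * ∑ y, ζ x y * GQs x y * A y := by
  simp [bg244, Matrix.mulVec, dotProduct, Matrix.hadamard_apply, Finset.mul_sum, mul_assoc]

/-- With ζ ≡ 1 (no cut-off) (2.44) is (I.3.29): a_k(L^kε)^{−2}G^ε_kQ^*_kA. KERNEL. [cite: Balaban1982Higgs2, (2.44) p.566] -/
theorem bg244_one {X Y : Type} [Fintype Y] (ak ℓ : ℝ) (GQs : Matrix X Y ℝ) (A : Y → ℝ) :
    bg244 ak ℓ (Matrix.of fun _ _ => 1) GQs A = (ak * (ℓ ^ 2)⁻¹) • (GQs *ᵥ A) := by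
  unfold bg244
  congr 2
  ext x y
  simp [Matrix.hadamard_apply]

/-- The printed properties of the cut-off ζ^{(k)} (p. 566): *"|(∂^η_xζ^{(k)})(b,y)| ≤ 1, supp ζ^{(k)}(·,y) is contained in
the set {x ∈ T_η : |x − y| < r(L^kε) − 2M} and ζ^{(k)}(x,y) = 1 if |x − y| ≤ ½r(L^kε)"*. DICTIONARY `dist x y` ↤ |x − y|
(x ∈ T_η, y ∈ T₁^{(k)} embedded), `dζ b y` ↤ (∂^η_xζ^{(k)})(b,y) over the bonds `B` of T_η, `r` ↤ r(L^kε) = `B2.rFn R r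
(L^kε)`, `M` the big-block size. [cite: Balaban1982Higgs2, (2.44) p.566] -/
def IsCutoff244 {X Y B : Type} (ζ : X → Y → ℝ) (dζ : B → Y → ℝ) (dist : X → Y → ℝ) (r M : ℝ) : Prop :=
  (∀ b y, |dζ b y| ≤ 1) ∧ (∀ x y, ζ x y ≠ 0 → dist x y < r - 2 * M) ∧ (∀ x y, dist x y ≤ r / 2 → ζ x y = 1)

/-! ## (2.55) p. 570: the restrictions χ_k -/

/-- Ā^{(k)}_b = L^{−k}Σ_{⟨x,x′⟩⊂b}A^{(k)}_{⟨x,x′⟩} ((2.55) p. 570): the average of the fine bond field over the L^k fine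
bonds of the coarse bond b. DICTIONARY `fine b` ↤ the fine bonds ⟨x,x′⟩ ⊂ b, `w` ↤ L^{−k}. [cite: Balaban1982Higgs2, (2.55) p.570] -/
def bondAvg {α β : Type} (w : ℝ) (fine : β → Finset α) (A : α → ℝ) (b : β) : ℝ :=
  w * ∑ e ∈ fine b, A e

/-- **(2.55)** p. 570 at one point x / bond b of Λ^{(k−1)}′_{−1}: *"|(∂A)(b)| ≤ c₁p(L^{k−1}ε), |A(x)| ≤
(c₁/(μ₀L^{k−1}ε))p(L^{k−1}ε), |(D_{Ā^{(k)}}φ)(b)| ≤ c₁p(L^{k−1}ε), |φ(x)| ≤ (c₁/λ(L^{k−1}ε)^{1/4})p(L^{k−1}ε)"*. DICTIONARY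
`pℓ` ↤ p(L^{k−1}ε) (`B2.pFn`), `tA` ↤ 1/(μ₀L^{k−1}ε), `tPhi` ↤ 1/λ(L^{k−1}ε)^{1/4} (the thresholds of (2.2), cf.
`…B2LargeField.thrA`, `.thrPhi`), `dA`, `absA`, `dPhi`, `absPhi` ↤ the four printed absolute values.
[cite: Balaban1982Higgs2, (2.55) p.570] -/
def Restr255At (c₁ pℓ tA tPhi dA absA dPhi absPhi : ℝ) : Prop :=
  dA ≤ c₁ * pℓ ∧ absA ≤ c₁ * tA * pℓ ∧ dPhi ≤ c₁ * pℓ ∧ absPhi ≤ c₁ * tPhi * pℓ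

/-- (2.55) is monotone in c₁ (for non-negative thresholds): used when the paper replaces c₁ by "a suitably larger
constant O(1)" (e.g. p. 561, p. 563). KERNEL. [cite: Balaban1982Higgs2, (2.55) p.570] -/
theorem Restr255At.mono {c₁ c₂ pℓ tA tPhi dA absA dPhi absPhi : ℝ} (hc : c₁ ≤ c₂) (hp : 0 ≤ pℓ) (htA : 0 ≤ tA)
    (htPhi : 0 ≤ tPhi) (h : Restr255At c₁ pℓ tA tPhi dA absA dPhi absPhi) :
    Restr255At c₂ pℓ tA tPhi dA absA dPhi absPhi := by
  obtain ⟨h1, h2, h3, h4⟩ := h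
  refine ⟨h1.trans ?_, h2.trans ?_, h3.trans ?_, h4.trans ?_⟩
  · exact mul_le_mul_of_nonneg_right hc hp
  · exact mul_le_mul_of_nonneg_right (mul_le_mul_of_nonneg_right hc htA) hp
  · exact mul_le_mul_of_nonneg_right hc hp
  · exact mul_le_mul_of_nonneg_right (mul_le_mul_of_nonneg_right hc htPhi) hp

/-! ## Proposition 2.1 (2.57) p. 570 and the final-step estimate (2.116) p. 582 -/

/-- Carrier for Prop. 2.1 / (2.116): for each step k of a run, `P k` ↤ 𝒫^{(k)}(Λ₇^{(k−1)}′, θ_kA^{(k)}, φ), `Ploc k` ↤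
𝒫^{(k)}(Λ₇^{(k)}, θ_kA^{(k)}, φ) (re-localized), `quart k` ↤ λ(L^kε)Σ_{x∈B^k(Λ₇^{(k−1)}′∩Λ₇^{(k)c})}η^d|φ^{(k)}(x)|⁴ (φ^{(k)} of
(2.56)), `volDiff k` ↤ |Λ₇^{(k−1)}′ ∩ Λ₇^{(k)c}|, `vol7 k` ↤ |Λ₇^{(k)}|, `ell k` ↤ L^kε, `restr k` ↤ "the conditions (2.55)
hold", `K` ↤ the final step. [cite: Balaban1982Higgs2, Prop. 2.1 (2.57) p.570, (2.116) p.582] -/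
structure P21Setting where
  K : ℕ
  P : ℕ → ℝ
  Ploc : ℕ → ℝ
  quart : ℕ → ℝ
  volDiff : ℕ → ℝ
  vol7 : ℕ → ℝ
  ell : ℕ → ℝ
  restr : ℕ → Prop

/-- **Proposition 2.1** (2.57) p. 570 (verbatim in the module docstring): under (2.55), 𝒫^{(k)}(Λ₇^{(k−1)}′,…) =
−(quartic term) + 𝒫^{(k)}(Λ₇^{(k)},…) + O((L^kε)^{κ₀})|Λ₇^{(k−1)}′∩Λ₇^{(k)c}| — one κ₀ > 0 and one O-constant for all
runs and steps.  Proof deferred in print to B3 ("a corollary of the analysis of the perturbation expansions").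
[cite: Balaban1982Higgs2, Prop. 2.1 (2.57) p.570] -/
def Prop21Printed {J : Type} (fam : J → P21Setting) : Prop :=
  ∃ κ₀ C : ℝ, 0 < κ₀ ∧ ∀ (j : J) (k : ℕ), (fam j).restr k →
    |(fam j).P k - (-(fam j).quart k + (fam j).Ploc k)| ≤ C * (fam j).ell k ^ κ₀ * (fam j).volDiff k

/-- **(2.116)** p. 582 (the final step k = K, L^Kε ≤ ε₀ < L^{K+1}ε): *"𝒫^{(K),L^Kε}(Λ₇^{(K−1)}, B^{(K),ε}, ψ) ≤
O((L^Kε)^{κ₀})|Λ₇^{(K)}|"*. [cite: Balaban1982Higgs2, (2.116) p.582] -/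
def Ineq2116Printed {J : Type} (fam : J → P21Setting) : Prop :=
  ∃ κ₀ C : ℝ, 0 < κ₀ ∧ ∀ j : J,
    (fam j).P (fam j).K ≤ C * (fam j).ell (fam j).K ^ κ₀ * (fam j).vol7 (fam j).K

/-! ## Proposition 2.2 (2.58) pp. 570–571 -/

/-- Carrier for Prop. 2.2: one INSTANCE = (k, Ω ⊂ Ω₀, A, e = e(L^kε)) as in Prop. I.2.1 (`…B1.Prop21Printed` /
`…B4.EtaSetting`).  `Bond` ↤ bonds b ⊂ Ω of T_η, `Site` ↤ points of Ω, `KSite` ↤ points y ∈ Ω^{(k)}; `regular` ↤ A regular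
on Ω ((I.2.23)), `bigBlocks` ↤ Ω, Ω₀ unions of big blocks; `bdist b` ↤ dist(b,Ωᶜ), `xdist x` ↤ dist(x,Ωᶜ), `ydist y` ↤
dist(y,Ωᶜ); `dby b y` ↤ dist(b,y), `dxy x y` ↤ dist(x,y); kernels `kDGQ b y` ↤ |(D^η_AG_k(Ω,A)Q_k^*(A))(b,y)|, `kGQ x y` ↤
|(G_k(Ω,A)Q_k^*(A))(x,y)|, and `kdDGQ`, `kdGQ` the same for δG_k(Ω,Ω₀,A) = G_k(Ω,A) − G_k(Ω₀,A).
[cite: Balaban1982Higgs2, Prop. 2.2 (2.58) pp.570–571] -/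
structure P22Setting where
  Bond : Type
  Site : Type
  KSite : Type
  e : ℝ
  regular : Prop
  bigBlocks : Prop
  bdist : Bond → ℝ
  xdist : Site → ℝ
  ydist : KSite → ℝ
  dby : Bond → KSite → ℝ
  dxy : Site → KSite → ℝ
  kDGQ : Bond → KSite → ℝ
  kGQ : Site → KSite → ℝ
  kdDGQ : Bond → KSite → ℝ
  kdGQ : Site → KSite → ℝ

/-- **Proposition 2.2** (pp. 570–571, verbatim in the module docstring): for e(L^kε) small, δ₀, c₀, R₀ > 0 (depending
on d, a, M only) with (2.58) |(D^η_AG_kQ_k^*)(b,y)| ≤ c₀e^{−δ₀dist(b,y)} for dist(b,Ωᶜ) ≥ R₀, the same for G_kQ_k^*, and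
for the δG_k versions with the extra factor exp(−δ₀(dist(b,Ωᶜ) + dist(y,Ωᶜ))).  Quantifier shape aligned with
`…B1.Prop21Printed` (δ₀, c₀, R₀ and the smallness threshold e₁, then the instance).  Printed as "a simple corollary of
Proposition I.2.1". [cite: Balaban1982Higgs2, Prop. 2.2 (2.58) pp.570–571] -/
def Prop22Printed {I : Type} (fam : I → P22Setting) : Prop :=
  ∃ δ₀ c₀ R₀ e₁ : ℝ, 0 < δ₀ ∧ 0 < c₀ ∧ 0 < R₀ ∧ 0 < e₁ ∧ ∀ i : I,
    (fam i).regular → (fam i).bigBlocks → 0 < (fam i).e → (fam i).e ≤ e₁ →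
      (∀ b y, R₀ ≤ (fam i).bdist b → (fam i).kDGQ b y ≤ c₀ * Real.exp (-(δ₀ * (fam i).dby b y))) ∧
      (∀ x y, R₀ ≤ (fam i).xdist x → (fam i).kGQ x y ≤ c₀ * Real.exp (-(δ₀ * (fam i).dxy x y))) ∧
      (∀ b y, R₀ ≤ (fam i).bdist b → (fam i).kdDGQ b y ≤
        c₀ * Real.exp (-(δ₀ * (fam i).dby b y)) * Real.exp (-(δ₀ * ((fam i).bdist b + (fam i).ydist y)))) ∧
      (∀ x y, R₀ ≤ (fam i).xdist x → (fam i).kdGQ x y ≤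
        c₀ * Real.exp (-(δ₀ * (fam i).dxy x y)) * Real.exp (-(δ₀ * ((fam i).xdist x + (fam i).ydist y))))

/-! ## Lemma 2.3 (2.59)–(2.60) p. 571 and the decomposition (2.61) of its proof -/

/-- Carrier for Lemma 2.3: one INSTANCE = one step k of a run with its fields.  `X` ↤ T_η (fine points), `Y` ↤ T₁^{(k)},
`Dir` ↤ directions μ; `blk x` ↤ the y with x ∈ B^k(y); `inL2 y` ↤ y ∈ Λ₂^{(k−1)}′; `Ak x` ↤ A^{(k)}(x) (one component),
`A y` ↤ A(y), `QsA x` ↤ (Q_k^*A)(x), `dAk μ x` ↤ |(∂^η_μA^{(k)})(x)|; `p` ↤ p(L^kε); `restr` ↤ the restrictions (2.55).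
[cite: Balaban1982Higgs2, Lemma 2.3 (2.59)–(2.60) p.571] -/
structure L23Setting where
  X : Type
  Y : Type
  Dir : Type
  blk : X → Y
  inL2 : Y → Prop
  Ak : X → ℝ
  A : Y → ℝ
  QsA : X → ℝ
  dAk : Dir → X → ℝ
  p : ℝ
  restr : Prop

/-- **Lemma 2.3** (p. 571, verbatim in the module docstring): under (2.55), A^{(k)}(x) = A(y) + O(p(L^kε)) =
(Q_k^*A)(x) + O(p(L^kε)) for x ∈ B^k(y), y ∈ Λ₂^{(k−1)}′ (2.59), and (∂^η_μA^{(k)})(x) = O(p(L^kε)) on B^k(Λ₂^{(k−1)}′)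
(2.60) — the O-constant uniform over instances.  Printed proof: (2.61)–(2.64) from Prop. 2.2, (2.55) and the
properties of ζ^{(k)}. [cite: Balaban1982Higgs2, Lemma 2.3 (2.59)–(2.60) p.571] -/
def Lemma23Printed {I : Type} (fam : I → L23Setting) : Prop :=
  ∃ C : ℝ, ∀ i : I, (fam i).restr →
    (∀ x, (fam i).inL2 ((fam i).blk x) →
      |(fam i).Ak x - (fam i).A ((fam i).blk x)| ≤ C * (fam i).p ∧ |(fam i).Ak x - (fam i).QsA x| ≤ C * (fam i).p) ∧
    (∀ μ x, (fam i).inL2 ((fam i).blk x) → (fam i).dAk μ x ≤ C * (fam i).p)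

/-- **(2.61)** p. 571, KERNEL (module algebra): with T ↤ G_kQ_k^* and T_ζ ↤ ζ^{(k)}G_kQ_k^* (both linear from block
fields to fine fields), `one` ↤ the constant block field 1, c ↤ A(y):
a_kT_ζ(A − c·1) − a_k·c·(T − T_ζ)1 + a_k·c·T1 = a_kT_ζA (= A^{(k)} of (2.44)).  *"(1 − ζ^{(k)})G_kQ_k^*"* = T − T_ζ.
[cite: Balaban1982Higgs2, (2.61) p.571] -/
theorem display261 {M M' : Type} [AddCommGroup M] [Module ℝ M] [AddCommGroup M'] [Module ℝ M']
    (ak c : ℝ) (T Tz : M' →ₗ[ℝ] M) (A one : M') :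
    ak • Tz (A - c • one) - ak • (c • (T one - Tz one)) + ak • (c • T one) = ak • Tz A := by
  simp only [map_sub, map_smul, smul_sub]
  module

/-! ## Lemma 2.5 (2.81) p. 574, the computation (2.83)–(2.85) of its proof, and (2.86) -/

/-- Carrier for Lemma 2.5: one INSTANCE = one step k.  `X` ↤ points x of the L-lattice (x ∈ B(y)), `Y` ↤ T₁^{(k+1)}
(block points y), `blk x` ↤ y; `inL1 y` ↤ y ∈ Λ₁^{(k)}′; `CQsB x` ↤ aL^{−2}(C^{(k)}_{Λ₀^{(k)}}Q^*B)(x) (one component), `B y` ↤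
B(y), `QsB x` ↤ (Q^*B)(x); `p` ↤ p(L^kε); `restr` ↤ the restrictions on B ((2.17) at scale L^kε).
[cite: Balaban1982Higgs2, Lemma 2.5 (2.81) p.574] -/
structure L25Setting where
  X : Type
  Y : Type
  blk : X → Y
  inL1 : Y → Prop
  CQsB : X → ℝ
  B : Y → ℝ
  QsB : X → ℝ
  p : ℝ
  restr : Prop

/-- **Lemma 2.5** (2.81) p. 574: aL^{−2}(C^{(k)}_{Λ₀^{(k)}}Q^*B)(x) = B(y) + O(p(L^kε)) = (Q^*B)(x) + O(p(L^kε)), x ∈ B(y),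
y ∈ Λ₁^{(k)}′ — O-constant uniform.  Printed proof: (2.82)–(2.85) (Prop. I.2.3 + restrictions on B + the constant-field
computation `display284`/`display285`). [cite: Balaban1982Higgs2, Lemma 2.5 (2.81) p.574] -/
def Lemma25Printed {I : Type} (fam : I → L25Setting) : Prop :=
  ∃ C : ℝ, ∀ i : I, (fam i).restr → ∀ x, (fam i).inL1 ((fam i).blk x) →
    |(fam i).CQsB x - (fam i).B ((fam i).blk x)| ≤ C * (fam i).p ∧ |(fam i).CQsB x - (fam i).QsB x| ≤ C * (fam i).p

/-- **(2.84)** p. 574, KERNEL: from (I.2.21) Δ^{(k)}1 = a_k1 − a_k²Q_kG_kQ_k^*1 and (2.63) a_kG_kQ_k^*1 =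
(1 − μ/(a_k + μ))1 (`B2.display263`; μ ↤ μ₀²(L^kε)², Q_k1 = 1): a_k − a_k(1 − μ/(a_k + μ)) = a_kμ/(a_k + μ).
[cite: Balaban1982Higgs2, (2.84) p.574] -/
theorem display284 {ak μ : ℝ} (h : ak + μ ≠ 0) : ak - ak * (1 - μ / (ak + μ)) = ak * μ / (ak + μ) := by
  field_simp
  ring

/-- **(2.83) + (2.85)** p. 574–575, KERNEL: on constants C^{(k)} = (aL^{−2}P + Δ^{(k)})^{−1} acts as the number
(aL^{−2} + δ)^{−1} with δ = Δ^{(k)}1 = a_kμ/(a_k + μ) (2.84), so aL^{−2}C^{(k)}1 = aL^{−2}/(aL^{−2} + δ) =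
(1 + a^{−1}L²a_kμ/(a_k + μ))^{−1} — the printed (2.85). [cite: Balaban1982Higgs2, (2.83)–(2.85) pp.574–575] -/
theorem display285 {a L ak μ : ℝ} (ha : a ≠ 0) (hL : L ≠ 0) (h : ak + μ ≠ 0) :
    a * (L ^ 2)⁻¹ / (a * (L ^ 2)⁻¹ + ak * μ / (ak + μ)) = (1 + a⁻¹ * L ^ 2 * (ak * μ / (ak + μ)))⁻¹ := by
  have h2 : 1 + a⁻¹ * L ^ 2 * (ak * μ / (ak + μ)) = (a * (L ^ 2)⁻¹)⁻¹ * (a * (L ^ 2)⁻¹ + ak * μ / (ak + μ)) := by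
    field_simp
  rw [h2, mul_inv, inv_inv, div_eq_mul_inv]

/-- **(2.85), "= 1 + O(μ₀²(L^kε)²)"** p. 575, KERNEL with the constant made explicit: for a, a_k > 0, L ≠ 0 and μ ≥ 0
(μ ↤ μ₀²(L^kε)²), |(1 + a^{−1}L²a_kμ/(a_k + μ))^{−1} − 1| ≤ (L²/a)·μ  (since 0 ≤ t := a^{−1}L²a_kμ/(a_k + μ) ≤ a^{−1}L²μ and
|(1 + t)^{−1} − 1| = t/(1 + t) ≤ t). [cite: Balaban1982Higgs2, (2.85) p.575] -/
theorem display285_bound {a L ak μ : ℝ} (ha : 0 < a) (hak : 0 < ak) (hμ : 0 ≤ μ) :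
    |(1 + a⁻¹ * L ^ 2 * (ak * μ / (ak + μ)))⁻¹ - 1| ≤ L ^ 2 / a * μ := by
  set t : ℝ := a⁻¹ * L ^ 2 * (ak * μ / (ak + μ)) with ht
  have hakμ : 0 < ak + μ := by linarith
  have ht0 : 0 ≤ t := by rw [ht]; positivity
  have hfrac : ak * μ / (ak + μ) ≤ μ := by
    rw [div_le_iff₀ hakμ]
    nlinarith
  have htle : t ≤ L ^ 2 / a * μ := by
    rw [ht]
    have : a⁻¹ * L ^ 2 * (ak * μ / (ak + μ)) ≤ a⁻¹ * L ^ 2 * μ :=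
      mul_le_mul_of_nonneg_left hfrac (by positivity)
    calc a⁻¹ * L ^ 2 * (ak * μ / (ak + μ)) ≤ a⁻¹ * L ^ 2 * μ := this
      _ = L ^ 2 / a * μ := by ring
  have h1t : 0 < 1 + t := by linarith
  have e : (1 + t)⁻¹ - 1 = -(t / (1 + t)) := by
    field_simp
    ring
  rw [e, abs_neg, abs_of_nonneg (by positivity)]
  calc t / (1 + t) ≤ t := div_le_self ht0 (by linarith)
    _ ≤ L ^ 2 / a * μ := htle

/-- **(2.86)** p. 575, KERNEL (triangle inequality): |A′(x)| = |A(x) − aL^{−2}(C^{(k)}_{Λ₀}Q^*B)(x)| ≤ |A(x) − (Q^*B)(x)| +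
|(Q^*B)(x) − aL^{−2}(C^{(k)}_{Λ₀}Q^*B)(x)| ≤ C₁p + C₂p — from the restriction |A(x) − (Q^*B)(x)| ≤ C₁p(L^kε) ((2.17) at scale
L^kε) and Lemma 2.5. DICTIONARY `Ax`, `QsBx`, `CQsBx` ↤ A(x), (Q^*B)(x), aL^{−2}(C^{(k)}_{Λ₀^{(k)}}Q^*B)(x).
[cite: Balaban1982Higgs2, (2.86) p.575] -/
theorem display286 {Ax QsBx CQsBx C₁ C₂ p : ℝ} (h1 : |Ax - QsBx| ≤ C₁ * p) (h2 : |CQsBx - QsBx| ≤ C₂ * p) :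
    |Ax - CQsBx| ≤ (C₁ + C₂) * p := by
  calc |Ax - CQsBx| = |(Ax - QsBx) - (CQsBx - QsBx)| := by ring_nf
    _ ≤ |Ax - QsBx| + |CQsBx - QsBx| := abs_sub _ _
    _ ≤ C₁ * p + C₂ * p := add_le_add h1 h2
    _ = (C₁ + C₂) * p := by ring

/-! ## Proposition 2.6 p. 580, the kernel bound (2.109), Lemma 2.7 (2.113) p. 581 -/

/-- Carrier for Prop. 2.6: for each step k, `diffTerms k` ↤ the sum of all interaction terms localized in B^k(Λ₇^{(k)})
containing at least one difference G_k(B^{k−1}(Λ₂^{(k−1)}),B̃) − G_k(B^k(Λ₂^{(k)}),B^{(k+1),η}), `vol7 k` ↤ |Λ₇^{(k)}|, `ell k`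
↤ L^kε, `d` the dimension. [cite: Balaban1982Higgs2, Prop. 2.6 p.580] -/
structure P26Setting where
  d : ℕ
  diffTerms : ℕ → ℝ
  vol7 : ℕ → ℝ
  ell : ℕ → ℝ

/-- **Proposition 2.6** (p. 580, verbatim in the module docstring): the propagator replacement costs
O((L^kε)^κ)|Λ₇^{(k)}| — typed with one κ > d (the exponent of the context, pp. 578–579) and one O-constant for all runs
and steps.  Proof deferred in print to B3. [cite: Balaban1982Higgs2, Prop. 2.6 p.580] -/
def Prop26Printed {J : Type} (fam : J → P26Setting) : Prop :=
  ∃ κ C : ℝ, (∀ j, ((fam j).d : ℝ) < κ) ∧ ∀ (j : J) (k : ℕ),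
    |(fam j).diffTerms k| ≤ C * (fam j).ell k ^ κ * (fam j).vol7 k

/-- **(2.109)** p. 580, first inequality, as a predicate on a kernel: |h_k(x,x′)| ≤ C·exp(−δ₁r)·exp(−δ₀|x − x′|) for all
x, x′ (↤ points of Λ₆^{(k−1)}′; `r` ↤ r(L^kε)). [cite: Balaban1982Higgs2, (2.109) p.580] -/
def KernelBound2109 {X : Type} (h : X → X → ℝ) (dist : X → X → ℝ) (C δ₁ δ₀ r : ℝ) : Prop :=
  ∀ x x', |h x x'| ≤ C * Real.exp (-(δ₁ * r)) * Real.exp (-(δ₀ * dist x x'))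

/-- **(2.109)** p. 580, second inequality (*"≤ O((L^kε)^κ) … for … arbitrary κ"*), TYPED: with r(ℓ) = R(1 + log ℓ⁻¹)^r,
r > 1 (`B2.rFn`), the factor exp(−δ₁r(ℓ)) is smaller than every power of ℓ on (0,1]: ∀κ ∃C_κ ∀ℓ ∈ (0,1],
exp(−δ₁r(ℓ)) ≤ C_κℓ^κ.  Elementary real analysis; PROVED at the end of this module for δ₁, R > 0, r > 1
(`rDecayBeatsPowers`, `rDecayBeatsPowers_of_printed`; v1.1). [cite: Balaban1982Higgs2, (2.109) p.580] -/
def RDecayBeatsPowers (δ₁ R r : ℝ) : Prop :=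
  ∀ κ : ℝ, ∃ C : ℝ, ∀ ℓ : ℝ, 0 < ℓ → ℓ ≤ 1 → Real.exp (-(δ₁ * B2.rFn R r ℓ)) ≤ C * ℓ ^ κ

/-- The two halves of (2.109) combine: a kernel bound with exp(−δ₁r(L^kε)) and `RDecayBeatsPowers` give, for every κ,
|h_k(x,x′)| ≤ (C·C_κ)(L^kε)^κ·exp(−δ₀|x − x′|). KERNEL. [cite: Balaban1982Higgs2, (2.109) p.580] -/
theorem kernelBound2109_pow {X : Type} {h : X → X → ℝ} {dist : X → X → ℝ} {C δ₁ δ₀ R r ℓ : ℝ} (hC : 0 ≤ C)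
    (hk : KernelBound2109 h dist C δ₁ δ₀ (B2.rFn R r ℓ)) (hR : RDecayBeatsPowers δ₁ R r) (hℓ : 0 < ℓ) (hℓ1 : ℓ ≤ 1)
    (κ : ℝ) : ∃ C' : ℝ, ∀ x x', |h x x'| ≤ C' * ℓ ^ κ * Real.exp (-(δ₀ * dist x x')) := by
  obtain ⟨Cκ, hCκ⟩ := hR κ
  refine ⟨C * Cκ, fun x x' => (hk x x').trans ?_⟩
  have h1 := hCκ ℓ hℓ hℓ1
  have h2 : C * Real.exp (-(δ₁ * B2.rFn R r ℓ)) ≤ C * (Cκ * ℓ ^ κ) := mul_le_mul_of_nonneg_left h1 hC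
  calc C * Real.exp (-(δ₁ * B2.rFn R r ℓ)) * Real.exp (-(δ₀ * dist x x'))
      ≤ C * (Cκ * ℓ ^ κ) * Real.exp (-(δ₀ * dist x x')) :=
        mul_le_mul_of_nonneg_right h2 (Real.exp_pos _).le
    _ = C * Cκ * ℓ ^ κ * Real.exp (-(δ₀ * dist x x')) := by ring

/-- Carrier for Lemma 2.7 (the scalar-field analogue of Lemma 2.5): `X` ↤ points x ∈ Λ₅^{(k)}, `CQsψ x` ↤
aL^{−2}(C^{(k)}_{Λ₄^{(k)}}(B^k(Λ₂^{(k)}),B^{(k+1),η})Q^*(B^{(k+1),η})ψ)(x) (one component), `Qsψ x` ↤ (Q^*(B^{(k+1),η})ψ)(x),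
`inL5 x` ↤ x ∈ Λ₅^{(k)}, `p` ↤ p(L^kε), `restr` ↤ the restrictions on ψ, φ. [cite: Balaban1982Higgs2, Lemma 2.7 (2.113) p.581] -/
structure L27Setting where
  X : Type
  inL5 : X → Prop
  CQsψ : X → ℝ
  Qsψ : X → ℝ
  p : ℝ
  restr : Prop

/-- **Lemma 2.7** (2.113) p. 581: aL^{−2}(C^{(k)}_{Λ₄^{(k)}}(…)Q^*(B^{(k+1),η})ψ)(x) = (Q^*(B^{(k+1),η})ψ)(x) + O(p(L^kε)),
x ∈ Λ₅^{(k)} — O-constant uniform; proof "omitted" in print ("based on the ideas … in the proofs of Lemmas 2.4 and 2.5").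
[cite: Balaban1982Higgs2, Lemma 2.7 (2.113) p.581] -/
def Lemma27Printed {I : Type} (fam : I → L27Setting) : Prop :=
  ∃ C : ℝ, ∀ i : I, (fam i).restr → ∀ x, (fam i).inL5 x → |(fam i).CQsψ x - (fam i).Qsψ x| ≤ C * (fam i).p

/-! ## §2.D p. 582: (2.117) and the geometric-series bound (2.118) — (2.118) KERNEL -/

/-- Carrier for (2.117): one RUN at spacing `eps` (K steps, L^Kε ≤ ε₀ < L^{K+1}ε): `lhs C₁` ↤ the left side of (2.117)
— ∫dB∫dψ Σ_{Λ₀^{(0)},…,Λ₀^{(K−1)}} ρ^{(K),L^Kε}(…)exp(−E₀)·exp(C₁ε^{κ₀}|Λ₇^{(0)c}| + Σ_{j=1}^{K−1}C₁(L^jε)^{κ₀}|Λ₇^{(j−1)}′∩Λ₇^{(j)c}| +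
C₁(L^{K−1}ε)^{κ₀}|Λ₇^{(K−1)}|) — as a function of the O(1)-constant C₁ GIVEN on the left; `volT` ↤ |T_ε|.
[cite: Balaban1982Higgs2, (2.117) p.582] -/
structure Run2117 where
  eps : ℝ
  volT : ℝ
  lhs : ℝ → ℝ

/-- **(2.117)** p. 582, *"the fundamental inequality necessary to complete the proof of the upper bound"* (p. 592),
TYPED: for every constant C₁ on the left there is C₂ *"independent of ε"* with lhs ≤ exp(C₂|T_ε|) for every run of
the family.  Proved in B2 §3 via (3.42) (`…B2.Claim342Printed`). [cite: Balaban1982Higgs2, (2.117) p.582] -/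
def Ineq2117Printed {J : Type} (fam : J → Run2117) : Prop :=
  ∀ C₁ : ℝ, ∃ C₂ : ℝ, ∀ j : J, (fam j).lhs C₁ ≤ Real.exp (C₂ * (fam j).volT)

/-- **The geometric series of (2.118)** p. 582, KERNEL: for L > 1, κ₀ > 0, ε > 0 and L^Kε ≤ 1 (the stopping rule
gives L^Kε ≤ ε₀ ≤ 1), Σ_{j=0}^{K−1}(L^jε)^{κ₀} ≤ 1/(L^{κ₀} − 1) — a bound independent of ε and K.
[cite: Balaban1982Higgs2, (2.118) p.582] -/
theorem sum_scale_rpow_le {L ε κ₀ : ℝ} {K : ℕ} (hL : 1 < L) (hε : 0 < ε) (hκ : 0 < κ₀) (hK : L ^ K * ε ≤ 1) :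
    ∑ j ∈ range K, (L ^ j * ε) ^ κ₀ ≤ (L ^ κ₀ - 1)⁻¹ := by
  have hL0 : 0 ≤ L := by linarith
  set Q : ℝ := L ^ κ₀ with hQ
  have hQ1 : 1 < Q := Real.one_lt_rpow hL hκ
  have hpow : ∀ n : ℕ, (L ^ n) ^ κ₀ = Q ^ n := by
    intro n
    rw [hQ, ← Real.rpow_natCast L n, ← Real.rpow_mul hL0, ← Real.rpow_natCast (L ^ κ₀) n,
      ← Real.rpow_mul hL0, mul_comm]
  have hterm : ∀ j : ℕ, (L ^ j * ε) ^ κ₀ = Q ^ j * ε ^ κ₀ := by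
    intro j
    rw [Real.mul_rpow (by positivity) hε.le, hpow]
  simp_rw [hterm]
  rw [← Finset.sum_mul, geom_sum_eq hQ1.ne']
  have hQK : Q ^ K * ε ^ κ₀ = (L ^ K * ε) ^ κ₀ := by
    rw [Real.mul_rpow (by positivity) hε.le, hpow]
  have hle1 : (L ^ K * ε) ^ κ₀ ≤ 1 := Real.rpow_le_one (by positivity) hK hκ.le
  have hQ1' : 0 < Q - 1 := by linarith
  have hεκ : 0 < ε ^ κ₀ := Real.rpow_pos_of_pos hε _
  have key : (Q ^ K - 1) * ε ^ κ₀ ≤ 1 := by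
    have : Q ^ K * ε ^ κ₀ ≤ 1 := by rw [hQK]; exact hle1
    nlinarith
  calc (Q ^ K - 1) / (Q - 1) * ε ^ κ₀ = ((Q ^ K - 1) * ε ^ κ₀) / (Q - 1) := by ring
    _ ≤ 1 / (Q - 1) := div_le_div_of_nonneg_right key hQ1'.le
    _ = (Q - 1)⁻¹ := one_div _

/-- **(2.118)** p. 582, KERNEL: with |T₁^{(j)}| = (L^jε)^{−d}|T_ε| and κ = d + κ₀, a family of coefficients |c_j| ≤ C
gives *"Σ_{j=0}^{K−1}O((L^jε)^κ)|T₁^{(j)}| = Σ_{j=0}^{K−1}O(1)(L^jε)^{κ₀}|T_ε| ≤ O(1)|T_ε|"* with the explicit O(1) =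
C/(L^{κ₀} − 1). DICTIONARY `volT` ↤ |T_ε| ≥ 0, `c j` ↤ the O-coefficients. [cite: Balaban1982Higgs2, (2.118) p.582] -/
theorem display2118 {L ε κ₀ volT C : ℝ} {d K : ℕ} (c : ℕ → ℝ) (hL : 1 < L) (hε : 0 < ε) (hκ : 0 < κ₀)
    (hK : L ^ K * ε ≤ 1) (hvol : 0 ≤ volT) (hc : ∀ j, |c j| ≤ C) :
    ∑ j ∈ range K, c j * (L ^ j * ε) ^ ((d : ℝ) + κ₀) * ((L ^ j * ε) ^ (-(d : ℝ)) * volT)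
      ≤ C * (L ^ κ₀ - 1)⁻¹ * volT := by
  have hpos : ∀ j : ℕ, 0 < L ^ j * ε := fun j => by positivity
  have e : ∀ j : ℕ, c j * (L ^ j * ε) ^ ((d : ℝ) + κ₀) * ((L ^ j * ε) ^ (-(d : ℝ)) * volT)
      = c j * (L ^ j * ε) ^ κ₀ * volT := by
    intro j
    have h := hpos j
    have hd : (L ^ j * ε) ^ ((d : ℝ) + κ₀) * (L ^ j * ε) ^ (-(d : ℝ)) = (L ^ j * ε) ^ κ₀ := by
      rw [← Real.rpow_add h, show (d : ℝ) + κ₀ + -(d : ℝ) = κ₀ by ring]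
    calc c j * (L ^ j * ε) ^ ((d : ℝ) + κ₀) * ((L ^ j * ε) ^ (-(d : ℝ)) * volT)
        = c j * ((L ^ j * ε) ^ ((d : ℝ) + κ₀) * (L ^ j * ε) ^ (-(d : ℝ))) * volT := by ring
      _ = c j * (L ^ j * ε) ^ κ₀ * volT := by rw [hd]
  simp_rw [e]
  have hC : 0 ≤ C := (abs_nonneg _).trans (hc 0)
  calc ∑ j ∈ range K, c j * (L ^ j * ε) ^ κ₀ * volT
      ≤ ∑ j ∈ range K, C * (L ^ j * ε) ^ κ₀ * volT := by
        refine Finset.sum_le_sum fun j _ => ?_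
        have h1 : c j ≤ C := (le_abs_self _).trans (hc j)
        have h2 : 0 ≤ (L ^ j * ε) ^ κ₀ * volT := mul_nonneg (Real.rpow_nonneg (hpos j).le _) hvol
        nlinarith
    _ = C * (∑ j ∈ range K, (L ^ j * ε) ^ κ₀) * volT := by
        rw [Finset.mul_sum, Finset.sum_mul]
    _ ≤ C * (L ^ κ₀ - 1)⁻¹ * volT := by
        have := sum_scale_rpow_le hL hε hκ hK
        gcongr

/-! ## (2.109) p. 580, *"≤ O((L^kε)^κ)exp(−δ₀|x − x′|) … for … arbitrary κ"* — PROOF of `RDecayBeatsPowers` (v1.1)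

The text (p. 580 [PDF 26]) passes from |h_k(x,x′)| ≤ O(1)exp(−δ₁r(L^kε))exp(−δ₀|x − x′|) to O((L^kε)^κ) for arbitrary κ
without comment; the reason is the super-linear growth of r(ℓ) = R(1 + log ℓ⁻¹)^r in log ℓ⁻¹ (r > 1, (2.7) p. 558): with
t = log ℓ⁻¹ ≥ 0 one has ℓ^κ = e^{−κt} and δ₁R(1 + t)^r = δ₁R(1 + t)(1 + t)^{r−1} ≥ κt as soon as (1 + t)^{r−1} ≥ κ/(δ₁R),
while for the finitely many smaller t the constant C_κ = e^{|κ|T} absorbs the power.  (The same comparison proves the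
(2.3) remark "exp(−c₀p(ε)²) ≤ ε^K" in the sibling `…B2LargeField`, v1.1.) -/

section RDecayProof

/-- Growth comparison (private copy of `B2LargeField.linear_le_mul_rpow_eventually`, kept local so that this module's
imports stay `…B2` only): for a > 0, s > 1 and any real κ there is T ≥ 0 with κt ≤ a(1 + t)^s for all t ≥ T.
[cite: Balaban1982Higgs2, (2.109) p.580] -/
private theorem linear_le_mul_rpow_eventually {a s : ℝ} (ha : 0 < a) (hs : 1 < s) (κ : ℝ) :
    ∃ T : ℝ, 0 ≤ T ∧ ∀ t : ℝ, T ≤ t → κ * t ≤ a * (1 + t) ^ s := by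
  by_cases hκ : κ ≤ 0
  · refine ⟨0, le_rfl, fun t ht => ?_⟩
    have h1 : 0 ≤ a * (1 + t) ^ s := mul_nonneg ha.le (Real.rpow_nonneg (by linarith) _)
    exact (mul_nonpos_of_nonpos_of_nonneg hκ ht).trans h1
  push Not at hκ
  have hs1 : 0 < s - 1 := by linarith
  set M : ℝ := κ / a with hM
  have hMpos : 0 < M := div_pos hκ ha
  refine ⟨M ^ (s - 1)⁻¹, Real.rpow_nonneg hMpos.le _, fun t ht => ?_⟩
  have hT0 : 0 ≤ M ^ (s - 1)⁻¹ := Real.rpow_nonneg hMpos.le _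
  have h1t : 0 < 1 + t := by linarith
  have hsplit : (1 + t) ^ s = (1 + t) * (1 + t) ^ (s - 1) := by
    conv_lhs => rw [show s = 1 + (s - 1) by ring]
    rw [Real.rpow_add h1t, Real.rpow_one]
  have hlow : M ≤ (1 + t) ^ (s - 1) := by
    calc M = (M ^ (s - 1)⁻¹) ^ (s - 1) := (Real.rpow_inv_rpow hMpos.le hs1.ne').symm
      _ ≤ (1 + t) ^ (s - 1) := Real.rpow_le_rpow hT0 (by linarith) hs1.le
  calc κ * t = a * (t * M) := by rw [hM]; field_simp
    _ ≤ a * ((1 + t) * (1 + t) ^ (s - 1)) := by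
        apply mul_le_mul_of_nonneg_left _ ha.le
        exact mul_le_mul (by linarith) hlow hMpos.le h1t.le
    _ = a * (1 + t) ^ s := by rw [hsplit]

/-- **(2.109), "arbitrary κ"** p. 580, KERNEL: `RDecayBeatsPowers δ₁ R r` holds for every δ₁ > 0, R > 0 and r > 1 (the
printed ranges of (2.7): r > 1, R > R₀), with C_κ = e^{|κ|T}, T the threshold of `linear_le_mul_rpow_eventually` for
a = δ₁R, s = r. [cite: Balaban1982Higgs2, (2.109) p.580, (2.7) p.558] -/
theorem rDecayBeatsPowers {δ₁ R r : ℝ} (hδ : 0 < δ₁) (hR : 0 < R) (hr : 1 < r) : RDecayBeatsPowers δ₁ R r := by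
  intro κ
  have ha : 0 < δ₁ * R := mul_pos hδ hR
  obtain ⟨T, hT0, hT⟩ := linear_le_mul_rpow_eventually ha hr κ
  refine ⟨Real.exp (|κ| * T), fun ℓ hℓ hℓ1 => ?_⟩
  set t : ℝ := Real.log ℓ⁻¹ with ht
  have ht0 : 0 ≤ t := by
    rw [ht, Real.log_inv]
    have := Real.log_nonpos hℓ.le hℓ1
    linarith
  have h1t : 0 < 1 + t := by linarith
  have hpow : ℓ ^ κ = Real.exp (-(κ * t)) := by
    rw [Real.rpow_def_of_pos hℓ, ht, Real.log_inv]
    ring_nf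
  rw [hpow, ← Real.exp_add, Real.exp_le_exp, B2.rFn, ← ht, ← mul_assoc]
  have hnn : 0 ≤ δ₁ * R * (1 + t) ^ r := mul_nonneg ha.le (Real.rpow_nonneg h1t.le _)
  by_cases hcase : T ≤ t
  · have h1 := hT t hcase
    have h2 : 0 ≤ |κ| * T := mul_nonneg (abs_nonneg κ) hT0
    linarith
  · push Not at hcase
    have h1 : κ * t ≤ |κ| * T :=
      calc κ * t ≤ |κ| * t := mul_le_mul_of_nonneg_right (le_abs_self κ) ht0
        _ ≤ |κ| * T := mul_le_mul_of_nonneg_left hcase.le (abs_nonneg κ)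
    linarith

/-- (2.109) "arbitrary κ" for the PRINTED parameter ranges (`B2.Params.Printed`: r > 1, R > 0) and any δ₁ > 0 (the
decay rate of Prop. 2.2 / I.2.3). KERNEL. [cite: Balaban1982Higgs2, (2.109) p.580] -/
theorem rDecayBeatsPowers_of_printed (P : B2.Params) (hP : P.Printed) {δ₁ : ℝ} (hδ : 0 < δ₁) :
    RDecayBeatsPowers δ₁ P.R P.r := by
  obtain ⟨-, hr, -, -, -, -, -, hR⟩ := hP
  exact rDecayBeatsPowers hδ hR hr

/-- (2.109) assembled for the printed ranges: a kernel bound `KernelBound2109 h dist C δ₁ δ₀ (r(ℓ))` with C ≥ 0, δ₁ > 0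
and `P.Printed` gives, for every κ and every ℓ = L^kε ∈ (0,1], |h(x,x′)| ≤ C′ℓ^κ exp(−δ₀|x − x′|) — the printed
*"≤ O((L^kε)^κ)exp(−δ₀|x − x′|)"* with NO standing hypothesis left. KERNEL. [cite: Balaban1982Higgs2, (2.109) p.580] -/
theorem kernelBound2109_pow_of_printed (P : B2.Params) (hP : P.Printed) {X : Type} {h : X → X → ℝ}
    {dist : X → X → ℝ} {C δ₁ δ₀ ℓ : ℝ} (hC : 0 ≤ C) (hδ : 0 < δ₁)
    (hk : KernelBound2109 h dist C δ₁ δ₀ (B2.rFn P.R P.r ℓ)) (hℓ : 0 < ℓ) (hℓ1 : ℓ ≤ 1) (κ : ℝ) :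
    ∃ C' : ℝ, ∀ x x', |h x x'| ≤ C' * ℓ ^ κ * Real.exp (-(δ₀ * dist x x')) :=
  kernelBound2109_pow hC hk (rDecayBeatsPowers_of_printed P hP hδ) hℓ hℓ1 κ

/-- **(2.109), the constant `O((Lᵏε)^κ)` UNIFORM IN THE STEP** (v1.2, r14 gen 7): for a FAMILY of kernels `h_j` on carriers
`X_j` with scales `ℓ_j = Lᵏε ∈ (0,1]`, all obeying the first inequality of (2.109) with ONE `(C, δ₁, δ₀)` and `r = r(ℓ_j)`, and
`exp(−δ₁r(ℓ))` beating every power (`RDecayBeatsPowers`), there is for every `κ` ONE `C′` with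
`|h_j(x,x′)| ≤ C′ℓ_j^κ exp(−δ₀|x − x′|)` for ALL `j` — the printed *"≤ O((Lᵏε)^κ)exp(−δ₀|x − x′|) … for … arbitrary κ"* with the
`O(·)` independent of `k`, `ε`, the regions and the fields (`kernelBound2109_pow` is the one-scale case; its `C′ = C·C_κ`
was already scale-free, this version says so in the statement). KERNEL. [cite: Balaban1982Higgs2, (2.109) p.580] -/
theorem kernelBound2109_pow_family {J : Type} {X : J → Type} {h : (j : J) → X j → X j → ℝ}
    {dist : (j : J) → X j → X j → ℝ} {ℓ : J → ℝ} {C δ₁ δ₀ R r : ℝ} (hC : 0 ≤ C)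
    (hk : ∀ j, KernelBound2109 (h j) (dist j) C δ₁ δ₀ (B2.rFn R r (ℓ j))) (hR : RDecayBeatsPowers δ₁ R r)
    (hℓ : ∀ j, 0 < ℓ j) (hℓ1 : ∀ j, ℓ j ≤ 1) (κ : ℝ) :
    ∃ C' : ℝ, ∀ j x x', |h j x x'| ≤ C' * ℓ j ^ κ * Real.exp (-(δ₀ * dist j x x')) := by
  obtain ⟨Cκ, hCκ⟩ := hR κ
  refine ⟨C * Cκ, fun j x x' => (hk j x x').trans ?_⟩
  have h1 := hCκ (ℓ j) (hℓ j) (hℓ1 j)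
  have h2 : C * Real.exp (-(δ₁ * B2.rFn R r (ℓ j))) ≤ C * (Cκ * ℓ j ^ κ) := mul_le_mul_of_nonneg_left h1 hC
  calc C * Real.exp (-(δ₁ * B2.rFn R r (ℓ j))) * Real.exp (-(δ₀ * dist j x x'))
      ≤ C * (Cκ * ℓ j ^ κ) * Real.exp (-(δ₀ * dist j x x')) :=
        mul_le_mul_of_nonneg_right h2 (Real.exp_pos _).le
    _ = C * Cκ * ℓ j ^ κ * Real.exp (-(δ₀ * dist j x x')) := by ring

/-- The same for the printed ranges (`P.Printed`: `r(ℓ) = R(1 + log ℓ⁻¹)^r`, `R > 0`, `r > 1`), every `δ₁ > 0`: ONE `C′` for the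
whole family and every `κ`. KERNEL. [cite: Balaban1982Higgs2, (2.109) p.580] -/
theorem kernelBound2109_pow_family_of_printed (P : B2.Params) (hP : P.Printed) {J : Type} {X : J → Type}
    {h : (j : J) → X j → X j → ℝ} {dist : (j : J) → X j → X j → ℝ} {ℓ : J → ℝ} {C δ₁ δ₀ : ℝ} (hC : 0 ≤ C) (hδ : 0 < δ₁)
    (hk : ∀ j, KernelBound2109 (h j) (dist j) C δ₁ δ₀ (B2.rFn P.R P.r (ℓ j))) (hℓ : ∀ j, 0 < ℓ j) (hℓ1 : ∀ j, ℓ j ≤ 1)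
    (κ : ℝ) : ∃ C' : ℝ, ∀ j x x', |h j x x'| ≤ C' * ℓ j ^ κ * Real.exp (-(δ₀ * dist j x x')) :=
  kernelBound2109_pow_family hC hk (rDecayBeatsPowers_of_printed P hP hδ) hℓ hℓ1 κ

end RDecayProof

end Literature.MathematicalPhysics.QuantumFieldTheory.Balaban1983to89.B2StepK
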